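import Mathlib

/-!
# Fixed points of `τ^p` versus fixed points of `τ`: `#Fix(τ^p) ≡ #Fix(τ) (mod p)` (kernel tool)

Framing: lottery ticket; floor = certified bounds/negative ranges.  Cell pub-namedobj (venture DiscreteObjects),
target (H) = `H(668)`, hadamard gen 28; tool for the COMPOSITE-ORDER census of automorphisms of `srg(333,166,82,83)`
(⇔ symmetric `C(334)`): for an automorphism `τ` of order `p·q`, the fixed-point windows of `τ^p` (order `q`) and
`τ^q` (order `p`) from `ConferenceGraph333PrimeSpectrum` combine with
* **`card_fixed_pow_prime_modEq`** — for any permutation `τ` of a finite type and any prime `p`,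
  `#{x | τ^p x = x} ≡ #{x | τ x = x} (mod p)`: `τ` permutes the fixed points of `τ^p` with `τ^p = 1` there, so its
  non-trivial orbits on that set have size `p` (Mathlib `Equiv.Perm.card_compl_support_modEq` on the subtype);
* `card_fixed_le_card_fixed_pow` — `#{x | τ x = x} ≤ #{x | τ^n x = x}`.
E.g. an element of order `111 = 3·37` would need `#Fix(τ^37) ≡ #Fix(τ) = 0 (mod 37)` (`τ^3` of order `37` is
fixed-point-free) inside the order-3 window `{3, 9, …, 81}` — impossible (script-level list of excluded composite
orders in the seat's notes; kernel corollaries follow once the prime windows land).  Mathlib only; no `sorry`.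
-/

namespace Summit.Ventures.DiscreteObjects.Hadamard

open Finset

section permpow
variable {V : Type*} [Fintype V] [DecidableEq V]

/-- `Fix(τ) ⊆ Fix(τ^n)`, counted. -/
theorem card_fixed_le_card_fixed_pow (τ : Equiv.Perm V) (n : ℕ) :
    (univ.filter fun x => τ x = x).card ≤ (univ.filter fun x => (τ ^ n) x = x).card := by
  refine Finset.card_le_card fun x hx => ?_
  rw [Finset.mem_filter] at hx ⊢
  exact ⟨hx.1, Equiv.Perm.pow_apply_eq_self_of_apply_eq_self hx.2 n⟩

/-- **`#Fix(τ^p) ≡ #Fix(τ) (mod p)`** for a permutation `τ` of a finite type and a prime `p`. -/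
theorem card_fixed_pow_prime_modEq (τ : Equiv.Perm V) (p : ℕ) [hp : Fact p.Prime] :
    (univ.filter fun x => (τ ^ p) x = x).card ≡ (univ.filter fun x => τ x = x).card [MOD p] := by
  -- restrict τ to the fixed points of τ^p
  have hinv : ∀ x, (τ ^ p) (τ x) = τ x ↔ (τ ^ p) x = x := by
    intro x
    rw [← Equiv.Perm.mul_apply, ← pow_succ, pow_succ', Equiv.Perm.mul_apply, τ.injective.eq_iff]
  set W := {x // (τ ^ p) x = x} with hW
  set τW : Equiv.Perm W := τ.subtypePerm hinv with hτW
  have hτWp : τW ^ p ^ 1 = 1 := by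
    rw [pow_one, hτW, Equiv.Perm.subtypePerm_pow]
    ext ⟨x, hx⟩
    simp [Equiv.Perm.subtypePerm_apply, hx]
  have hmod := Equiv.Perm.card_compl_support_modEq hτWp
  -- card W
  have hcardW : Fintype.card W = (univ.filter fun x => (τ ^ p) x = x).card := Fintype.card_subtype _
  -- fixed points of τW
  have hfixW : τW.supportᶜ.card = (univ.filter fun x => τ x = x).card := by
    have h1 : τW.supportᶜ = univ.filter (fun w : W => τW w = w) := by
      ext w; simp [Equiv.Perm.mem_support]
    rw [h1, ← Fintype.card_subtype, ← Fintype.card_subtype]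
    exact Fintype.card_congr
      { toFun := fun w => ⟨w.1.1, congrArg Subtype.val w.2⟩
        invFun := fun x => ⟨⟨x.1, Equiv.Perm.pow_apply_eq_self_of_apply_eq_self x.2 p⟩, Subtype.ext x.2⟩
        left_inv := fun w => rfl
        right_inv := fun x => rfl }
  rw [hcardW, hfixW] at hmod
  exact hmod.symm

end permpow

end Summit.Ventures.DiscreteObjects.Hadamard
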